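import Mathlib.Data.Vector.Basic
import Mathlib.Analysis.SpecialFunctions.Log.Base
import Literature.Computability.Complexity.PolynomialEntropyApproximation
import HarnessLib

/-!
# `PEA_d ≤ₚ PED_d`: entropy approximation Karp-reduces to entropy difference (DGRV §3), I

Dvir–Gutfreund–Rothblum–Vadhan [DGRV, §3, p. 6 ("In the other direction, we get that PEA reduces
to PED …")]: to compare `H(p(U_n))` with a threshold, compare it with the entropy of a FLAT map of
known entropy — the identity map on `F₂^k` has entropy exactly `k`.  In the tree's conventions
(`PEA d`: YES `H(p) ≥ k + 1`, NO `H(p) ≤ k`, integer `k`; `PED d`: YES `H(p) ≥ H(q) + 1`, NO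
`H(p) + 1 ≤ H(q)`) the two gap conventions are matched by one direct square [DGRV, §3 p. 6,
`H(pᵗ) = t · H(p)`]: `(n, p, k) ↦ ((2n, p × p), (2k+1, id_{2k+1}))`, since `2H(p) ≥ 2k + 2` on YES
and `2H(p) + 1 ≤ 2k + 1` on NO instances.  The threshold `k` is given in binary, so the identity
map on `2k + 1` variables is only written when `k < m` (the number of output polynomials of `p`);
otherwise `H(p) ≤ m ≤ k` (`PolyMapF2.entropy_le_length`) and the instance, never a YES instance,
is sent to a fixed NO instance of `PED d` (which needs `d ≥ 1`; `PED 0` has an empty promise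
while `PEA 0` has NO instances, so `PEA 0 ≤ₚ PED 0` fails).

This file: the semantic half — `PolyMapF2.entropy_le_length` (`H(p(U_n)) ≤ m`),
the identity map `PolyMapF2.idMap` and its entropy, `entropy_prod_self`, the instance map
`PEAToPED.reduce` and its correctness on YES / NO instances.  The polynomial-time clause and the
reduction `PEA_polyTimeReducible_PED` are in `PEAToPEDFP.lean`.

## References

* Z. Dvir, D. Gutfreund, G. N. Rothblum, S. Vadhan, *On approximating the entropy of polynomial
  mappings*, ECCC TR10-160 (2010) / ICS 2011, §3 p. 6 (PEA versus PED), Claim 2.2 (flat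
  distributions).  bib `DvirGutfreundRothblumVadhan2010`.
* T. Cover, J. Thomas, *Elements of Information Theory*, 2nd ed., Thm 2.6.4 (`H(X) ≤ log |𝒳|`).
-/

namespace Literature.Computability.Complexity

open _root_.Computability Literature.InformationTheory.Entropy Finset

namespace PolyMapF2

variable {n : ℕ}

/-- **The output entropy of a sparse map with `m` output polynomials is at most `m` bits**:
`H(p(U_n)) ≤ m` (the output ranges over at most `2^m` strings of `m` bits).
[Cover–Thomas, 2nd ed., Thm 2.6.4; DGRV 2010, §2] [cite: DvirGutfreundRothblumVadhan2010, §2] -/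
theorem entropy_le_length (P : PolyMapF2 n) : P.entropy ≤ P.length := by
  classical
  have hS : (Finset.univ : Finset (Fin n → ZMod 2)).Nonempty := Finset.univ_nonempty
  have hbound : ∀ z : Unit, (((Finset.univ : Finset (Fin n → ZMod 2)).image P.eval).filter
      fun y => (fun _ : List (ZMod 2) => ()) y = z).card ≤ 2 ^ P.length := by
    intro z
    calc (((Finset.univ : Finset (Fin n → ZMod 2)).image P.eval).filter
            fun y => (fun _ : List (ZMod 2) => ()) y = z).card
        ≤ ((Finset.univ : Finset (List.Vector (ZMod 2) P.length)).image
            (fun v => v.toList)).card := by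
          refine Finset.card_le_card fun y hy => ?_
          rw [Finset.mem_filter, Finset.mem_image] at hy
          obtain ⟨⟨x, -, rfl⟩, -⟩ := hy
          exact Finset.mem_image.2 ⟨⟨P.eval x, P.length_eval x⟩, Finset.mem_univ _, rfl⟩
      _ ≤ (Finset.univ : Finset (List.Vector (ZMod 2) P.length)).card := Finset.card_image_le
      _ = 2 ^ P.length := by rw [Finset.card_univ, card_vector, ZMod.card]
  have h := mapEntropy_sub_le_mapEntropy_comp hS P.eval (fun _ : List (ZMod 2) => ()) P.length hbound
  have h0 : mapEntropy (Finset.univ : Finset (Fin n → ZMod 2)) ((fun _ : List (ZMod 2) => ()) ∘ P.eval) = 0 :=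
    mapEntropy_const _ ()
  unfold entropy
  linarith

/-- **The identity map on `F₂^m`** as a sparse map: output `i` is the single monomial `xᵢ`
(DGRV's flat map `q` "the identity map on `Fⁿ`" of entropy `n`).
[DGRV 2010, §3 p. 6] [cite: DvirGutfreundRothblumVadhan2010, §3 p.6] -/
def idMap (m : ℕ) : PolyMapF2 m :=
  (List.finRange m).map fun i => [[i]]

/-- The identity map on `F₂^m` has `m` outputs. [folklore] -/
@[simp] theorem length_idMap (m : ℕ) : (idMap m).length = m := by
  simp [idMap]

/-- The identity map evaluates to the list of coordinates. [folklore] -/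
theorem eval_idMap (m : ℕ) (x : Fin m → ZMod 2) : (idMap m).eval x = List.ofFn x := by
  simp [idMap, eval, List.ofFn_eq_map]

/-- The identity map has degree `1` (every monomial is a single variable). [folklore] -/
theorem degLE_idMap {d : ℕ} (hd : 1 ≤ d) (m : ℕ) : (idMap m).DegLE d := by
  intro p hp μ hμ
  simp only [idMap, List.mem_map, List.mem_finRange, true_and] at hp
  obtain ⟨i, rfl⟩ := hp
  rw [List.mem_singleton] at hμ
  subst hμ
  simpa using hd

/-- **The identity map on `F₂^m` is flat of entropy `m`**: `H(id(U_m)) = m`.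
[DGRV 2010, Claim 2.2 and §3 p. 6] [cite: DvirGutfreundRothblumVadhan2010, §3 p.6] -/
theorem entropy_idMap (m : ℕ) : (idMap m).entropy = m := by
  have hinj : Function.Injective (idMap m).eval := by
    intro x y h
    rw [eval_idMap, eval_idMap] at h
    exact List.ofFn_injective h
  unfold entropy
  rw [mapEntropy_of_injective _ hinj, Finset.card_univ, Fintype.card_fun, ZMod.card, Fintype.card_fin,
    Nat.cast_pow, Nat.cast_ofNat, Real.logb_pow, Real.logb_self_eq_one (by norm_num), mul_one]

/-- The direct square doubles the entropy: `H((p × p)(U_{2n})) = 2 H(p(U_n))`.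
[DGRV 2010, §3 p. 6 (`H(pᵗ) = t H(p)`)] [cite: DvirGutfreundRothblumVadhan2010, §3 p.6] -/
theorem entropy_prod_self (P : PolyMapF2 n) : (P.prod P).entropy = 2 * P.entropy := by
  rw [entropy_prod, two_mul]

end PolyMapF2

/-! ### The instance map `PEA_d → PED_d` -/

namespace PEAToPED

open PolyMapF2

/-- A fixed NO instance of `PED_d` (`d ≥ 1`): `p` the empty map on `F₂⁰` (`H = 0`), `q` the
identity on `F₂¹` (`H = 1`), so `H(p) + 1 ≤ H(q)`. [DGRV 2010, Def 3.2] [folklore] -/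
def noInst : PEDInst :=
  (⟨0, []⟩, ⟨1, idMap 1⟩)

/-- **The instance map** `(n, p, k) ↦ ((n + n, p × p), (2k + 1, id_{2k+1}))` when `k < m = |p|`, and
the fixed NO instance otherwise. [DGRV 2010, §3 p. 6] [cite: DvirGutfreundRothblumVadhan2010, §3 p.6] -/
def reduce (I : PEAInst) : PEDInst :=
  if I.2.2 < I.2.1.length then (⟨I.1 + I.1, I.2.1.prod I.2.1⟩, ⟨2 * I.2.2 + 1, idMap (2 * I.2.2 + 1)⟩)
  else noInst

/-- The fixed instance is a NO instance of `PED_d` for `d ≥ 1`. [DGRV 2010, Def 3.2] [folklore] -/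
theorem noInst_mem_no {d : ℕ} (hd : 1 ≤ d) : PEDInst.encoding.encode noInst ∈ (PED d).no := by
  rw [encode_mem_PED_no_iff]
  refine ⟨degLE_nil d, degLE_idMap hd 1, ?_⟩
  show PolyMapF2.entropy ([] : PolyMapF2 0) + 1 ≤ (idMap 1).entropy
  rw [entropy_nil, entropy_idMap]
  norm_num

/-- **YES ↦ YES**: if `deg p ≤ d` and `H(p) ≥ k + 1` then `k < |p|` (as `H(p) ≤ |p|`),
`2 H(p) ≥ (2k + 1) + 1 = H(id_{2k+1}) + 1`, and all degrees stay `≤ d` (`d ≥ 1`).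
[DGRV 2010, §3 p. 6] [cite: DvirGutfreundRothblumVadhan2010, §3 p.6] -/
theorem reduce_mem_yes {d : ℕ} (hd : 1 ≤ d) {I : PEAInst}
    (h : PEAInst.encoding.encode I ∈ (PEA d).yes) :
    PEDInst.encoding.encode (reduce I) ∈ (PED d).yes := by
  rw [encode_mem_PEA_yes_iff] at h
  obtain ⟨hdeg, hk⟩ := h
  have hlt : I.2.2 < I.2.1.length := by
    have := entropy_le_length I.2.1
    exact_mod_cast (show (I.2.2 : ℝ) < I.2.1.length by linarith)
  rw [reduce, if_pos hlt, encode_mem_PED_yes_iff]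
  refine ⟨hdeg.prod hdeg, degLE_idMap hd _, ?_⟩
  show (idMap (2 * I.2.2 + 1)).entropy + 1 ≤ (I.2.1.prod I.2.1).entropy
  rw [entropy_idMap, entropy_prod_self]
  push_cast
  linarith

/-- **NO ↦ NO**: if `deg p ≤ d` and `H(p) ≤ k` then either `k < |p|` and
`2 H(p) + 1 ≤ 2k + 1 = H(id_{2k+1})`, or the image is the fixed NO instance.
[DGRV 2010, §3 p. 6] [cite: DvirGutfreundRothblumVadhan2010, §3 p.6] -/
theorem reduce_mem_no {d : ℕ} (hd : 1 ≤ d) {I : PEAInst}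
    (h : PEAInst.encoding.encode I ∈ (PEA d).no) :
    PEDInst.encoding.encode (reduce I) ∈ (PED d).no := by
  rw [encode_mem_PEA_no_iff] at h
  obtain ⟨hdeg, hk⟩ := h
  by_cases hlt : I.2.2 < I.2.1.length
  · rw [reduce, if_pos hlt, encode_mem_PED_no_iff]
    refine ⟨hdeg.prod hdeg, degLE_idMap hd _, ?_⟩
    show (I.2.1.prod I.2.1).entropy + 1 ≤ (idMap (2 * I.2.2 + 1)).entropy
    rw [entropy_idMap, entropy_prod_self]
    push_cast
    linarith
  · rw [reduce, if_neg hlt]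
    exact noInst_mem_no hd

end PEAToPED

end Literature.Computability.Complexity
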